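import Summits.BirchSwinnertonDyer.BirchSwinnertonDyer.Theorems.KolyvaginDepthDoorDepthTableIntrinsic
import Literature.NumberTheory.EllipticCurves.BurungaleSkinnerTianWan2024.CyclotomicPConverseSkinnerUrbanProofs
import HarnessLib

/-!
# Route `KolyvaginDepthDoor`, crux `KolyvaginDepthSupplyKN` (stmt-BirchSwinnertonDyer-22820) —
# DEPTH TABLE v16, GENERIC: THE INTRINSIC FORM OF THE ODD-RANK ROW (`L`-value currency) — the twist model enters ONLY through
# its datum; every Heegner field, every admissible prime

Helper file of the lead prover of line `levelone` (kdd-p1 g20; `--supports stmt-BirchSwinnertonDyer-22820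
--as helper`); it closes nothing and BSD is NOT proved by it.

Companion of `KolyvaginDepthDoorDepthTableIntrinsic` (even rank). g18/g19's ODD-rank mechanism
`cruxBody_of_twistLValue_le_of_steinWuthrich_skinner` (Skinner 2016 Thm. C + GZK on the analytic-rank-ZERO Heegner twist) still asked on
the chosen globally minimal twist model `T`: good-ordinary-or-multiplicative reduction at `p`, Skinner's (ram) — a multiplicative prime
`ℓ ≠ p` with `p ∤ ord_ℓ Δ_min(T)` —, Kodaira–Néron at `p`, and `L(T,1) ≠ 0`. All of it is read on `E`:

* Kodaira–Néron on `T` is IDLE for the «≤» direction (Skinner's identity `ord_p(L(T,1)/Ω_T) = ord_p #Ш(T) + ord_p Tam(T)` has a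
  non-negative Tamagawa term): `natCard_selmerGroup_le_pow_of_rankZero_LValue'`.
* good ordinary reduction of `T` at `p ∤ 2 d_K`: `goodOrdinary_of_smul_eq_quadraticTwist_of_ne_zero` (square-class reduction + twisting formula).
* (ram) for `T` from (ram) for `E` with the SAME `ℓ`: `ℓ ∣ N_E` splits in the Heegner field, so `d_K ∈ (ℚ_ℓ^×)²` and `T ⊗ ℚ_ℓ ≅ E ⊗ ℚ_ℓ`
  — the tree theorem `BurungaleSkinnerTianWan2024.exists_ram_twist_of_satisfiesHeegnerHypothesis` (bookkeeping lemma, nothing of the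
  preprint asserted; uniform in `ℓ`, `ℓ = 2` included).
* `L(T,1) ≠ 0` is read on the canonical twist (`entireLFunction_smul`), and (ram) for `E` at `p` follows from ♠ (1) as soon as `E` has ONE
  multiplicative prime (`hmult`), which every curve of the odd-rank table has (semistable, `N > 1`).

* `cruxBody_of_twistLValue_intrinsic_spade` — **THE INTRINSIC ODD-RANK ROW MECHANISM, ♠ supply**: `W` globally minimal, non-CM,
  `2 ≤ rank`, `N_E ≤ 30 000`, with a multiplicative prime; `5 ≤ p < 1000` good ordinary, `ρ_{W,p^n}` onto, Kodaira–Néron, ♠ (1), ♠ (2);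
  `K` ANY imaginary quadratic Heegner field with `d_K ∉ {−3,−4}`, `p ∤ d_K`; `T` ANY globally minimal model of `E^{(d_K)}`; IF
  `L(E^{(d_K)}, 1) ≠ 0` and `ord_p(L(T,1)/Ω_T) ≤ k` with `k ≤ rank W`, THEN the clause of `KolyvaginDepthSupplyKN` holds at `W` VERBATIM.
  With `k = rank W = 3`: `p³ ∣ #Ш_an(T)·Tam(T)` is still tolerated (g19's tolerance).

CONDITIONAL on Stein–Wuthrich 2013 Thm. 1.1, W. Zhang 2014 L8.4 (1) / 9.1, Skinner 2016 Thm. C and GZK, BY NAME; per `(W, p, K)`; nothing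
class-wide on the open stub (S♭); BSD is NOT proved by any of this.

References: [Skinner2016PacificMC] Thm. C (p. 173); [Darmon2004] Thm. 3.22; [SteinWuthrich2013] Thm. 1.1 (p. 1758); [WZhang2014] Lemma 8.4 (1)
(p. 236), Thm. 9.1 (p. 240); [SilvermanAEC2009] VII.5 Prop. 5.1(b), X.4.2, X.5 Cor. 5.4, App. C §16; [NeukirchANT1999] Ch. II (4.6).
-/

set_option linter.dupNamespace false

noncomputable section

open scoped Classical NumberField

namespace Summit.BirchSwinnertonDyer.BirchSwinnertonDyer.Theorems.KolyvaginDepthDoor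

open Literature.NumberTheory.EllipticCurves Literature.NumberTheory.EllipticCurves.ModularForms
  WeierstrassCurve NumberField IsDedekindDomain
open Literature.NumberTheory.EllipticCurves.Rank1Residual
open Summit.BirchSwinnertonDyer.BirchSwinnertonDyer.Theorems

/-! ## Skinner's bound without Kodaira–Néron on the twist -/

/-- **ODD rank, with tolerance, NO Kodaira–Néron hypothesis: `#Sel_p(T/ℚ) ≤ p^k` from `ord_p(L(T,1)/Ω_T) ≤ k`** (Skinner 2016 Thm. C
+ GZK by name). As g19's `natCard_selmerGroup_le_pow_of_rankZero_LValue` but WITHOUT `p ∤ ord_v Δ_min(T)`: Skinner's identity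
`ord_p(L/Ω) = ord_p #Ш(T) + ord_p Tam(T)` has a non-negative Tamagawa term, so `ord_p #Ш(T) ≤ k` already follows; then `#Ш(T)[p] ≤ p^k`
and `#Sel_p(T) = #T(ℚ)[p] · #Ш(T)[p] ≤ p^k` (rank `0`, `T(ℚ)[p] = 0`). CONDITIONAL on the two named facts; per `(T, p)`; BSD is not
proved by it. [cite: Skinner2016PacificMC, Thm. C (p. 173)] [cite: Darmon2004, Thm. 3.22] [cite: SilvermanAEC2009, Thm. X.4.2] -/
theorem natCard_selmerGroup_le_pow_of_rankZero_LValue'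
    (hSk : Skinner2016_padicValRat_bsd_rank_zero) (hGZK : rank_eq_analyticRank_of_analyticRank_le_one)
    (T : WeierstrassCurve ℚ) [T.IsElliptic] [T.IsGloballyMinimal] (p : ℕ) [hp : Fact p.Prime] (h5 : 5 ≤ p)
    (hred : (T.HasGoodReductionAtPrime p ∧ ¬ (p : ℤ) ∣ T.frobeniusTrace p) ∨ T.HasMultiplicativeReductionAtPrime p)
    (hirr : T.HasIrreducibleModPGaloisRep p)
    (hram : ∃ q : ℕ, ∃ _ : Fact q.Prime, q ≠ p ∧ T.HasMultiplicativeReductionAtPrime q ∧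
      ¬ p ∣ padicValInt q T.minimalDiscriminantInt)
    (hL : T.entireLFunction 1 ≠ 0) (k : ℕ)
    (hval : ∀ q : ℚ, T.entireLFunction 1 / ((T.realPeriodRat : ℝ) : ℂ) = (q : ℂ) → padicValRat p q ≤ k) :
    Nat.card (T.selmerGroup p) ≤ p ^ k := by
  have h0 : T.analyticRank = 0 := analyticRank_eq_zero_of_entireLFunction_one_ne_zero T hL
  obtain ⟨hrank, hfin⟩ := hGZK T (by rw [h0]; norm_num)
  rw [h0] at hrank
  haveI : Finite T.sha := hfin
  obtain ⟨q, hq, hv⟩ := hSk T p (le_trans (by norm_num) h5) hred hirr hram hL hfin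
  have hvk : padicValRat p q ≤ k := hval q hq
  -- Skinner: `ord_p q = ord_p #Ш + ord_p Tam`; the Tamagawa term is `≥ 0` (no Kodaira–Néron needed)
  have hshak : padicValNat p T.shaOrder ≤ k := by
    have : ((padicValNat p T.shaOrder : ℕ) : ℤ) + ((padicValNat p T.tamagawaProduct : ℕ) : ℤ) ≤ k := by rw [← hv]; exact hvk
    omega
  have htor : Nat.card (AddSubgroup.torsionBy T.toAffine.Point (p : ℤ)) = 1 :=
    natCard_torsionBy_eq_one_of_hasIrreducibleModPGaloisRep T p hirr
  have hsha : Nat.card (T.sha ⊓ AddSubgroup.torsionBy T.galH1 (p : ℤ) : AddSubgroup T.galH1) ≤ p ^ k :=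
    (natCard_sha_inf_torsionBy_le_pow_padicValNat T p).trans
      (Nat.pow_le_pow_right hp.out.pos (by rwa [WeierstrassCurve.shaOrder] at hshak))
  have h := T.natCard_selmerGroup_eq hp.out.ne_zero
  rw [hrank, pow_zero, one_mul] at h
  rw [h]
  have key : ∀ {t s : ℕ}, t = 1 → s ≤ p ^ k → t * s ≤ p ^ k := by
    rintro t s rfl hs; simpa using hs
  exact key (by convert htor) hsha

/-! ## The intrinsic twist bound at odd rank: `#Sel_p(E^{(d_K)}) ≤ p^k` with every arithmetic side condition read on `E` -/

/-- **`#Sel_p(E^{(d_K)}/ℚ) ≤ p^k` from ONE `L`-VALUE valuation on ANY globally minimal model of the twist, every arithmetic side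
condition on `E`** (odd rank: the twist has analytic rank ZERO). `W` globally minimal, `p ≥ 5` good ordinary for `W` with `ρ̄_{W,p}` onto
and (ram) for `W` at `p` (a multiplicative prime `ℓ ≠ p` with `p ∤ ord_ℓ Δ_min(W)`); `K` imaginary quadratic Heegner for `N_E` with
`p ∤ d_K`; `T` any globally minimal model of `E^{(d_K)}` (`C • T = W.quadraticTwist d_K`). IF `L(E^{(d_K)}, 1) ≠ 0` and
`ord_p(L(T,1)/Ω_T) ≤ k`, THEN `#Sel_p(E^{(d_K)}/ℚ) ≤ p^k`: irreducibility (`hasIrreducibleModPGaloisRep_iff_of_smul_eq_quadraticTwist`),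
good ordinary reduction (`goodOrdinary_of_smul_eq_quadraticTwist_of_ne_zero`) and (ram)
(`BurungaleSkinnerTianWan2024.exists_ram_twist_of_satisfiesHeegnerHypothesis`) of `T` are DERIVED; `L(T,1)` moves along `C`
(`entireLFunction_smul`); then Skinner's bound without Kodaira–Néron and Selmer transport. CONDITIONAL on Skinner 2016 Thm. C and GZK by
name; BSD is not proved by it. [cite: Skinner2016PacificMC, Thm. C (p. 173)] [cite: Darmon2004, Thm. 3.22]
[cite: SilvermanAEC2009, VII.5 Prop. 5.1(b), X.4.2, X.5 Cor. 5.4] -/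
theorem natCard_selmerGroup_quadraticTwist_le_of_LValue_intrinsic
    (hSk : Skinner2016_padicValRat_bsd_rank_zero) (hGZK : rank_eq_analyticRank_of_analyticRank_le_one)
    (W : WeierstrassCurve ℚ) [W.IsElliptic] [W.IsGloballyMinimal]
    (p : ℕ) [hp : Fact p.Prime] (h5 : 5 ≤ p) (hgood : W.HasGoodReductionAtPrime p)
    (hord : ¬ (p : ℤ) ∣ W.frobeniusTrace p) (hsur : W.HasSurjectiveModNGaloisRep p)
    (hWram : ∃ ℓ : ℕ, ∃ _ : Fact ℓ.Prime, ℓ ≠ p ∧ W.HasMultiplicativeReductionAtPrime ℓ ∧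
      ¬ p ∣ padicValInt ℓ W.minimalDiscriminantInt)
    (K : Type) [Field K] [NumberField K] (hK : IsImaginaryQuadratic K)
    (hpD : ¬ ((p : ℤ) ∣ NumberField.discr K))
    [NeZero (W.conductorNorm ℤ)] (hH : SatisfiesHeegnerHypothesis (W.conductorNorm ℤ) K)
    (T : WeierstrassCurve ℚ) [T.IsElliptic] [T.IsGloballyMinimal] (C : VariableChange ℚ)
    (hC : C • T = W.quadraticTwist (NumberField.discr K : ℚ))
    (hL : (W.quadraticTwist (NumberField.discr K : ℚ)).entireLFunction 1 ≠ 0) (k : ℕ)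
    (hval : ∀ q : ℚ, T.entireLFunction 1 / ((T.realPeriodRat : ℝ) : ℂ) = (q : ℂ) → padicValRat p q ≤ k) :
    Nat.card ((W.quadraticTwist (NumberField.discr K : ℚ)).selmerGroup p) ≤ p ^ k := by
  have hd0 : NumberField.discr K ≠ 0 := NumberField.discr_ne_zero K
  have hdq : (NumberField.discr K : ℚ) ≠ 0 := by exact_mod_cast hd0
  haveI := W.isElliptic_quadraticTwist hdq
  have hpP : p.Prime := hp.out
  -- irreducibility, good ordinary reduction and (ram) of the twist model — all from `W`
  have hirrW : W.HasIrreducibleModPGaloisRep p := hasIrreducibleModPGaloisRep_of_hasSurjectiveModNGaloisRep W p hsur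
  have hirrT : T.HasIrreducibleModPGaloisRep p :=
    (W.hasIrreducibleModPGaloisRep_iff_of_smul_eq_quadraticTwist T hdq hC p).mpr hirrW
  have hp2d : ¬ ((p : ℤ) ∣ 2 * NumberField.discr K) := by
    intro h
    rcases (Nat.prime_iff_prime_int.mp hpP).dvd_or_dvd h with h2 | h2
    · have : p = 2 := (Nat.prime_dvd_prime_iff_eq hpP Nat.prime_two).mp (by exact_mod_cast h2)
      omega
    · exact hpD h2
  obtain ⟨hTgood, hTord⟩ := goodOrdinary_of_smul_eq_quadraticTwist_of_ne_zero W T hd0 hC p hp2d hgood hord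
  have hTram : ∃ ℓ : ℕ, ∃ _ : Fact ℓ.Prime, ℓ ≠ p ∧ T.HasMultiplicativeReductionAtPrime ℓ ∧
      ¬ p ∣ padicValInt ℓ T.minimalDiscriminantInt :=
    BurungaleSkinnerTianWan2024.exists_ram_twist_of_satisfiesHeegnerHypothesis W T K hK.1 hH hC p hWram
  -- `L(T,1)` along `C`
  have hLT : T.entireLFunction 1 ≠ 0 := by rw [← hC, entireLFunction_smul] at hL; exact hL
  have hSelT : Nat.card (T.selmerGroup p) ≤ p ^ k :=
    natCard_selmerGroup_le_pow_of_rankZero_LValue' hSk hGZK T p h5 (Or.inl ⟨hTgood, hTord⟩) hirrT hTram hLT k hval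
  rw [← natCard_selmerGroup_eq_of_variableChange (p : ℤ) hC]
  exact hSelT

/-! ## The intrinsic odd-rank mechanism on W. Zhang's ♠ cell -/

/-- **THE INTRINSIC ODD-RANK ROW MECHANISM, ♠ SUPPLY — every Heegner field, every admissible prime, NO hypothesis on the twist model.**
`W` globally minimal, non-CM, `2 ≤ rank_ℤ W(ℚ)`, `N_E ≤ 30 000`, with at least one multiplicative prime; `5 ≤ p < 1000` good ordinary,
`ρ_{W,p^n}` onto, Kodaira–Néron, ♠ (1), ♠ (2) (in `p`-form); `K` ANY imaginary quadratic field with `d_K ∉ {−3,−4}`, `p ∤ d_K`, Heegner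
for `N_E`; `T` ANY globally minimal model of `E^{(d_K)}`. IF `L(E^{(d_K)}, 1) ≠ 0` and `ord_p(L(T,1)/Ω_T) ≤ k` for some `k ≤ rank W`, THEN
the clause of `KolyvaginDepthSupplyKN` holds at `W` VERBATIM ((ram) for `W` at `p` is ♠ (1) at the multiplicative prime `hmult`, which is
`≠ p` since `p` is good; then `natCard_selmerGroup_quadraticTwist_le_of_LValue_intrinsic` and g17's `cruxBody_of_twistSelmer_of_steinWuthrich`).
CONDITIONAL on Stein–Wuthrich Thm. 1.1, W. Zhang L8.4 (1) / 9.1, Skinner 2016 Thm. C, GZK by name; per `(W, p, K)`; nothing class-wide (the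
open stub (S♭) is untouched); BSD is not proved by it. [cite: SteinWuthrich2013, Thm. 1.1 (p. 1758)]
[cite: WZhang2014, Lemma 8.4 (1) (p. 236), Thm. 9.1 (p. 240)] [cite: Skinner2016PacificMC, Thm. C (p. 173)] [cite: Darmon2004, Thm. 3.22] -/
theorem cruxBody_of_twistLValue_intrinsic_spade
    (hSW : SteinWuthrich2013_sha_inf_torsionBy_eq_bot_of_two_le_rank)
    (h84 : Literature.NumberTheory.EllipticCurves.WZhang2014_lemma84_exists_minimal_kolyvaginClass_one_selmerCard)
    (hSk : Skinner2016_padicValRat_bsd_rank_zero) (hGZK : rank_eq_analyticRank_of_analyticRank_le_one)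
    (W : WeierstrassCurve ℚ) [W.IsElliptic] [W.IsGloballyMinimal] (hcm : ¬ W.HasCM) (hr : 2 ≤ W.mordellWeilRank)
    (hN : W.conductorNorm ℤ ≤ 30000)
    (hmult : ∃ ℓ : ℕ, ∃ _ : Fact ℓ.Prime, W.HasMultiplicativeReductionAtPrime ℓ)
    (p : ℕ) [hp : Fact p.Prime] (h5 : 5 ≤ p) (hp1000 : p < 1000) (hgood : W.HasGoodReductionAtPrime p)
    (hord : ¬ (p : ℤ) ∣ W.frobeniusTrace p)
    (htower : ∀ n : ℕ, W.HasSurjectiveModNGaloisRep (p ^ n : ℕ))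
    (hKN : ∀ v : HeightOneSpectrum (𝓞 ℚ), W.HasMultiplicativeReductionAt v →
      ¬ p ∣ W.ordMinimalDiscriminant v)
    (hS1 : ∀ (ℓ : ℕ) [Fact ℓ.Prime], W.HasMultiplicativeReductionAtPrime ℓ →
      ¬ p ∣ padicValInt ℓ W.minimalDiscriminantInt)
    (hS2 : ¬ Squarefree (W.conductorNorm ℤ) →
      (∃ (ℓ : ℕ) (_ : Fact ℓ.Prime), W.HasMultiplicativeReductionAtPrime ℓ ∧
          ¬ p ∣ padicValInt ℓ W.minimalDiscriminantInt) ∧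
        ∃ (ℓ₁ ℓ₂ : ℕ) (_ : Fact ℓ₁.Prime) (_ : Fact ℓ₂.Prime), ℓ₁ ≠ ℓ₂ ∧
          W.HasMultiplicativeReductionAtPrime ℓ₁ ∧ W.HasMultiplicativeReductionAtPrime ℓ₂)
    (K : Type) [Field K] [NumberField K] (hK : IsImaginaryQuadratic K)
    (hD3 : NumberField.discr K ≠ -3) (hD4 : NumberField.discr K ≠ -4)
    (hpD : ¬ ((p : ℤ) ∣ NumberField.discr K))
    [iNZ : NeZero (W.conductorNorm ℤ)] (hH : SatisfiesHeegnerHypothesis (W.conductorNorm ℤ) K)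
    (T : WeierstrassCurve ℚ) [T.IsElliptic] [T.IsGloballyMinimal] (C : WeierstrassCurve.VariableChange ℚ)
    (hC : C • T = W.quadraticTwist (NumberField.discr K : ℚ))
    (hL : (W.quadraticTwist (NumberField.discr K : ℚ)).entireLFunction 1 ≠ 0)
    (k : ℕ) (hk : k ≤ W.mordellWeilRank)
    (hval : ∀ q : ℚ, T.entireLFunction 1 / ((T.realPeriodRat : ℝ) : ℂ) = (q : ℂ) → padicValRat p q ≤ k) :
    ∃ (p : ℕ) (hp : Fact p.Prime), 5 ≤ p ∧ W.HasGoodReductionAtPrime p ∧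
      ¬ (p : ℤ) ∣ W.frobeniusTrace p ∧ (∀ n : ℕ, W.HasSurjectiveModNGaloisRep (p ^ n : ℕ)) ∧
      (∀ v : HeightOneSpectrum (𝓞 ℚ), W.HasMultiplicativeReductionAt v →
        ¬ p ∣ W.ordMinimalDiscriminant v) ∧
      ∃ (K : Type) (_ : Field K) (_ : NumberField K), IsImaginaryQuadratic K ∧
        NumberField.discr K ≠ -3 ∧ NumberField.discr K ≠ -4 ∧
        ∃ (_ : NeZero (W.conductorNorm ℤ)), SatisfiesHeegnerHypothesis (W.conductorNorm ℤ) K ∧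
        ∃ (Dt : ModularParametrizationData W (W.conductorNorm ℤ)) (β : ℤ) (ι : K →+* ℂ) (n₁ : ℕ)
          (d : KolyvaginHeegnerData Dt β ι n₁), Squarefree n₁ ∧
          (∀ q ∈ n₁.primeFactors, Zhang2014.IsKolyvaginPrime (W.conductorNorm ℤ) W K p q) ∧
          d.kolyvaginClass hp.out 1 ≠ 0 ∧
          (n₁.primeFactors.card + 1 ≤ W.mordellWeilRank ∨
            (n₁.primeFactors.card ≤ W.mordellWeilRank ∧
              n₁.primeFactors.card + 1 ≤ (W.quadraticTwist (NumberField.discr K : ℚ)).mordellWeilRank)) := by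
  have hsur : W.HasSurjectiveModNGaloisRep p := by simpa only [pow_one] using htower 1
  -- (ram) for `W` at `p`: the multiplicative prime `ℓ` is `≠ p` (`p` is good) and ♠ (1) gives `p ∤ ord_ℓ Δ_min`
  have hWram : ∃ ℓ : ℕ, ∃ _ : Fact ℓ.Prime, ℓ ≠ p ∧ W.HasMultiplicativeReductionAtPrime ℓ ∧
      ¬ p ∣ padicValInt ℓ W.minimalDiscriminantInt := by
    obtain ⟨ℓ, hℓ, hmℓ⟩ := hmult
    refine ⟨ℓ, hℓ, ?_, hmℓ, hS1 ℓ hmℓ⟩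
    rintro rfl
    exact WeierstrassCurve.HasMultiplicativeReduction.not_hasGoodReduction (R := ℤ_[ℓ]) hmℓ hgood
  have hSel := natCard_selmerGroup_quadraticTwist_le_of_LValue_intrinsic hSk hGZK W p h5 hgood hord hsur hWram K hK hpD hH
    T C hC hL k hval
  exact cruxBody_of_twistSelmer_of_steinWuthrich hSW h84 W hcm hr hN p h5 hp1000 hgood hord htower hKN hS1 hS2
    K hK hD3 hD4 hpD hH (hSel.trans (Nat.pow_le_pow_right hp.out.pos hk))

end Summit.BirchSwinnertonDyer.BirchSwinnertonDyer.Theorems.KolyvaginDepthDoor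

end
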